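import Literature.AnabelianGeometry.EtaleTheta.TemperedFrobenioidOfBaseFieldHullReading
import Literature.AnabelianGeometry.EtaleTheta.Discharge.Sec5OfConnectedTemperoid
import Literature.AnabelianGeometry.EtaleTheta.Discharge.Sec4Prop42FixingSlotBaseFieldHull
import HarnessLib

/-!
# [EtTh] §5 ↔ §3 at the base-field hull: the constants of `B_N` READ AT THE `ρ`-COMPATIBLE BASE POINT, and the cyclotome identification
# `μ_N(B_N) ⥲ μ_N(ℚ̄_p)` — the DATA of the `ConstantsDictionary` knit at the hull (class (b) construction; Lemma 5.8 p.331 / PDF p.105)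

S. Mochizuki, *The étale theta function and its Frobenioid-theoretic manifestations*, Publ. RIMS **45** (2009) [MochizukiEtTh2009]:
Def. 4.1 (ii) p.313 (PDF p.87) («the natural surjective OUTER homomorphism `Π^tp_X ↠ Aut_D(B_N^bs)`»), Def. 4.1 (iii) (the natural action of
`Aut_C(B_N)` on `O^×(B_N^birat)`), Lemma 5.8 p.331 (PDF p.105) («the natural inclusion `K^× ↪ O^×(B_N^birat)`»; «`Π^tp_Y` [i.e., `G_K`, via the
natural surjection `Π^tp_Y ↠ G_K`] acts»; «`μ_N(B_N) ⊆ (K^×)^{1/N}`»), Def. 5.4 p.327 (PDF p.101) (theta-saturation), Def. 3.6 (iv) p.304 (PDF p.78)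
(`C^{bs-fld}`).  [cite: MochizukiEtTh2009, Lem 5.8 p.331 (PDF p.105); Def 4.1 (ii) p.313 (PDF p.87)]

abc-iut cell, layer L2, seat abc-iut-f-142 (gen 10); row (β1) «DICTIONARY KNIT (d) AT THE HULL», FILE 1 of 2 (abc-iut-L2-lead R1394 / R1446 / R1460 «GO BOTH
FILES», design finding ADOPTED R1460).  CLASS (b) CONSTRUCTION (definitions by `def`, theorem-form laws; no instance, no notation, no `Prop`-valued
definition, no sorry; nothing landed is edited) over abc-iut-L2-d3's base-field hull `BsFldHull.temperedFrobenioid p a ha X.isTempered Rq Sq` and its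
reading API (`TemperedFrobenioidOfBaseFieldHullReading.lean`, p506755: `reading`, `reading_biratAutModel`, `constEmb`), abc-iut-L2-t4's §4 setting
`BiKummerSetting.mkOfConnectedTemperoid` and §5 data `ThetaFrobenioid.ofConnectedTemperoidData` (`Discharge/Sec5OfConnectedTemperoid.lean`), for an
`N`-th root datum `Rt` (objects `A_N`, `B_N`).
* §1 TRANSPORT OF POINTS along `CosetCat Π ≌ B^temp(Π)⁰` (abc-iut-L3/L1 `CosetCat.equivConnectedPart`): the base point of `(equiv).inverse.map f` in terms
  of `f` and the counit (`pt_inverse_map_eq`) — bookkeeping the hull's reading needs and the tree did not yet state.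
* §2 THE DESIGN FINDING (R1460).  The hull reads a birational unit of `B_N` — a `Π^tp_X`-equivariant function on `B_N^{bs}` — at the base point `x_{B_N}`
  chosen by the equivalence, while `ρ = rhoOfBiKummerData` (abc-iut-L2-t4) is written through the chosen base point `x_{A_N}` of the Galois object
  `A_N^{bs}` (`galoisSurjOf`, Def. 4.1 (ii) — an OUTER homomorphism) transported by `(s^⊓_N)^{bs}`.  The two presentations differ by the **offset element**
  `g_N` (`offsetElt`: `(s^⊓_N)^{bs}(x_{A_N}) = g_N · x_{B_N}`, `rhoBasePt_eq_ρ_offsetElt`), and the natural action of `s^⊓-gp_N(ρ(y))` reads as `a(g_N⁻¹ y g_N)`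
  at `x_{B_N}`.  Reading instead AT THE `ρ`-COMPATIBLE BASE POINT — **`readingRho := a(g_N) · reading`** — the Galois law holds ON THE NOSE:
  **`readingRho_biratAutModel_of_baseMap`**: for `σ ∈ Aut_C(B_N)` over `ρ(y)`, `readingRho (σ · u) = a(y) · readingRho u` (Lemma 5.8 «`G_K` acts»);
  `readingRho` is injective and reads the constants `K^×` onto themselves (`readingRho_constEmb`, `a(Π^tp_X) ≤ G_K`).
* §3 **`muReadingEquiv : μ_N(B_N) ⥲ μ_N(ℚ̄_p) = T.mu`** (the datum `m` of abc-iut-L2-t11's `ConstantsDictionary`) for the §5 data over the hull, under the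
  single consequence `μ_N(ℚ̄_p) ⊆ K_{U_{B_N}}` of the Def. 5.4 slot (p527685): `μ_N(B_N) ↪ O^×(B_N) ↪ O^×(B_N^birat) → ℚ̄_p^×` read at `x^ρ_{B_N}` lands in
  `μ_N` (`muReadingHom`), is injective, and is ONTO because a constant function with torsion value has trivial divisor and is therefore `u_τ` for a
  unit `τ ∈ O^×(B_N)` ([FrdI] Thm. 5.2 (ii): abc-iut-w6-d037's `exists_units_unitsToRatFn_eq`), `N`-torsion by `unitsToRatFn_injective`; `mu_compat` of
  the dictionary then holds by construction (`coe_muReadingEquiv`).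
FILE 2 (`Discharge/Sec5ConstantsDictionaryAtBaseFieldHull.lean`, proof-only) assembles `ConstantsDictionary … (refl) muReadingEquiv ⊤ readingRho` at
`ofThetaSettingData` over `hullSetting` from these data.  Two proofs carry `maxHeartbeats` ≤ 800000 (the §4-setting structure `mkOfConnectedTemperoid` is
unfolded against the hull's own API; precedent p513309).
HONEST FRAMING: genuine constants / Galois action at a carrier with DEGENERATE divisor geometry (the hull's rational functions are constants); nothing asserts
that this carrier is print's tempered Frobenioid of a curve; nothing of [EtTh] beyond the typed statements is asserted; nothing here bears on [IUTchIII]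
Cor. 3.12; no side taken; typed ≠ proved elsewhere.
-/

noncomputable section

namespace Literature.AnabelianGeometry.EtaleTheta

open CategoryTheory Opposite Function Literature.AlgebraicGeometry.Frobenioids Literature.AnabelianGeometry.SemiGraphs
  Literature.AnabelianGeometry.SemiGraphs.GaloisObjects Literature.AlgebraicGeometry.Frobenioids.QuasiTemperoid.BTempConnected

namespace BsFldHull

/-! ## §1 Transport of points along `CosetCat Γ ≌ B^temp(Γ)⁰` -/

section Transport

variable {Γ : Type} [Group Γ] [TopologicalSpace Γ] [IsTopologicalGroup Γ] (hΓ : IsTempered Γ)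

/-- **Points along the equivalence**: for `f : T → T′` in `B^temp(Γ)⁰`, the coset map `(equiv).inverse.map f` followed by the counit
at `T′` is the counit at `T` followed by `f` (naturality of the counit, on points).  [cite: MochizukiFrdII2008, Ex 1.3 (i) p.11] -/
theorem counit_toFun_inverse_map {T T' : ConnectedPart (BTemp Γ)} (f : T ⟶ T')
    (x : ((CosetCat.equivConnectedPart hΓ).inverse.obj T).carrier) :
    (((CosetCat.equivConnectedPart hΓ).counitIso.app T').hom.hom.hom.hom
        (CosetCat.Hom.toFun ((CosetCat.equivConnectedPart hΓ).inverse.map f) x) : T'.obj.obj.V) =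
      f.hom.hom.hom (((CosetCat.equivConnectedPart hΓ).counitIso.app T).hom.hom.hom.hom x) :=
  congrArg (fun φ => (φ.hom.hom.hom x : T'.obj.obj.V)) ((CosetCat.equivConnectedPart hΓ).counit.naturality f)

/-- The inverse counit carries the translate `g·x_T` of the base point `x_T := ε_T(1·U)` to the coset `g·U`.
[cite: MochizukiFrdII2008, Ex 1.3 (i) p.11] -/
theorem counitInv_ρ_basePt (T : ConnectedPart (BTemp Γ)) (g : Γ) :
    (((CosetCat.equivConnectedPart hΓ).counitIso.app T).inv.hom.hom.hom
        (T.obj.obj.ρ g (((CosetCat.equivConnectedPart hΓ).counitIso.app T).hom.hom.hom.hom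
          ((1 : Γ) : ((CosetCat.equivConnectedPart hΓ).inverse.obj T).carrier))) :
        ((CosetCat.equivConnectedPart hΓ).inverse.obj T).carrier) =
      (g : ((CosetCat.equivConnectedPart hΓ).inverse.obj T).carrier) := by
  refine (hom_ρ ((CosetCat.equivConnectedPart hΓ).counitIso.app T).inv.hom g _).trans ?_
  have h : (((CosetCat.equivConnectedPart hΓ).counitIso.app T).inv.hom.hom.hom (((CosetCat.equivConnectedPart hΓ).counitIso.app T).hom.hom.hom.hom ((1 : Γ) : ((CosetCat.equivConnectedPart hΓ).inverse.obj T).carrier)) : ((CosetCat.equivConnectedPart hΓ).inverse.obj T).carrier) =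
      ((1 : Γ) : ((CosetCat.equivConnectedPart hΓ).inverse.obj T).carrier) :=
    congrArg (fun φ => (φ.hom.hom.hom ((1 : Γ) : ((CosetCat.equivConnectedPart hΓ).inverse.obj T).carrier) : ((CosetCat.equivConnectedPart hΓ).inverse.obj T).carrier)) ((CosetCat.equivConnectedPart hΓ).counitIso.app T).hom_inv_id
  rw [h]
  change g • ((1 : Γ) : ((CosetCat.equivConnectedPart hΓ).inverse.obj T).carrier) = _
  rw [MulAction.Quotient.smul_coe, smul_eq_mul, mul_one]

/-- **The base point of `(equiv).inverse.map f`**: if `f` sends the base point `x_T` to `g·x_{T′}`, then `pt ((equiv).inverse.map f) = g·U′`.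
[cite: MochizukiFrdII2008, Ex 1.3 (i) p.11] -/
theorem pt_inverse_map_eq {T T' : ConnectedPart (BTemp Γ)} (f : T ⟶ T') (g : Γ)
    (h : (f.hom.hom.hom (((CosetCat.equivConnectedPart hΓ).counitIso.app T).hom.hom.hom.hom
        ((1 : Γ) : ((CosetCat.equivConnectedPart hΓ).inverse.obj T).carrier)) : T'.obj.obj.V) =
      T'.obj.obj.ρ g (((CosetCat.equivConnectedPart hΓ).counitIso.app T').hom.hom.hom.hom
        ((1 : Γ) : ((CosetCat.equivConnectedPart hΓ).inverse.obj T').carrier))) :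
    CosetCat.pt ((CosetCat.equivConnectedPart hΓ).inverse.map f) = (g : ((CosetCat.equivConnectedPart hΓ).inverse.obj T').carrier) := by
  have h1 := counit_toFun_inverse_map hΓ f ((1 : Γ) : ((CosetCat.equivConnectedPart hΓ).inverse.obj T).carrier)
  rw [h] at h1
  have h2 := congrArg (fun z => (((CosetCat.equivConnectedPart hΓ).counitIso.app T').inv.hom.hom.hom z :
    ((CosetCat.equivConnectedPart hΓ).inverse.obj T').carrier)) h1
  dsimp only at h2
  rw [counitInv_ρ_basePt] at h2
  rw [← h2]
  have h3 := congrArg (fun φ => (φ.hom.hom.hom (CosetCat.Hom.toFun ((CosetCat.equivConnectedPart hΓ).inverse.map f) ((1 : Γ) : _)) :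
      ((CosetCat.equivConnectedPart hΓ).inverse.obj T').carrier)) ((CosetCat.equivConnectedPart hΓ).counitIso.app T').hom_inv_id
  exact h3.symm

end Transport

/-! ## §2 The `ρ`-compatible base point of `B_N^{bs}`, the offset element, and the reading of the constants there -/

section OffsetReading

variable (p : ℕ) [Fact p.Prime] {K : Type} [Field K] {X : TemperedArithmeticGroup.{0} K} {a : X.Pi →* GQp p}
  {ha : ∀ U : OpenSubgroup X.Pi, IsOpen ((U.toSubgroup.map a : Subgroup (GQp p)) : Set (GQp p))}
  {Rq Sq : ((ConnectedPart (BTemp X.Pi))ᵒᵖ ⥤ CommMonCat.{0}) → Prop}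
  {NH : Subgroup (Field.absoluteGaloisGroup K) → (temperedFrobenioid p a ha X.isTempered Rq Sq).category → ℕ+ → Prop} {A₀ : (temperedFrobenioid p a ha X.isTempered Rq Sq).category}
  {hA₀ : PreFrobenioid.IsFrobeniusTrivial (temperedFrobenioid p a ha X.isTempered Rq Sq).toElem A₀} {hA₀' : IsGaloisObj A₀.base.obj}
  {pullFrac : ∀ {A A' : (BiKummerSetting.mkOfConnectedTemperoid X (temperedFrobenioid p a ha X.isTempered Rq Sq) (temperedFrobenioid_monoidType p a ha X.isTempered Rq Sq) (hP p a ha X.isTempered Rq Sq) NH A₀ hA₀ hA₀').C} (_ : A' ⟶ A), (BiKummerSetting.mkOfConnectedTemperoid X (temperedFrobenioid p a ha X.isTempered Rq Sq) (temperedFrobenioid_monoidType p a ha X.isTempered Rq Sq) (hP p a ha X.isTempered Rq Sq) NH A₀ hA₀ hA₀').biratUnits A → (BiKummerSetting.mkOfConnectedTemperoid X (temperedFrobenioid p a ha X.isTempered Rq Sq) (temperedFrobenioid_monoidType p a ha X.isTempered Rq Sq) (hP p a ha X.isTempered Rq Sq) NH A₀ hA₀ hA₀').biratUnits A'}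
  {lv N : ℕ+} {θ : (BiKummerSetting.mkOfConnectedTemperoid X (temperedFrobenioid p a ha X.isTempered Rq Sq) (temperedFrobenioid_monoidType p a ha X.isTempered Rq Sq) (hP p a ha X.isTempered Rq Sq) NH A₀ hA₀ hA₀').biratUnits (BiKummerSetting.mkOfConnectedTemperoid X (temperedFrobenioid p a ha X.isTempered Rq Sq) (temperedFrobenioid_monoidType p a ha X.isTempered Rq Sq) (hP p a ha X.isTempered Rq Sq) NH A₀ hA₀ hA₀').Aodot} {Bl : (BiKummerSetting.mkOfConnectedTemperoid X (temperedFrobenioid p a ha X.isTempered Rq Sq) (temperedFrobenioid_monoidType p a ha X.isTempered Rq Sq) (hP p a ha X.isTempered Rq Sq) NH A₀ hA₀ hA₀').C} {Pl : (BiKummerSetting.mkOfConnectedTemperoid X (temperedFrobenioid p a ha X.isTempered Rq Sq) (temperedFrobenioid_monoidType p a ha X.isTempered Rq Sq) (hP p a ha X.isTempered Rq Sq) NH A₀ hA₀ hA₀').FractionPair θ Bl} {Rl : (BiKummerSetting.mkOfConnectedTemperoid X (temperedFrobenioid p a ha X.isTempered Rq Sq) (temperedFrobenioid_monoidType p a ha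 X.isTempered Rq Sq) (hP p a ha X.isTempered Rq Sq) NH A₀ hA₀ hA₀').NthRoot θ Pl lv pullFrac}
  (Rt : (BiKummerSetting.mkOfConnectedTemperoid X (temperedFrobenioid p a ha X.isTempered Rq Sq) (temperedFrobenioid_monoidType p a ha X.isTempered Rq Sq) (hP p a ha X.isTempered Rq Sq) NH A₀ hA₀ hA₀').NthRoot Rl.root Rl.pair N pullFrac)

/-- **The `ρ`-compatible base point of `B_N^{bs}`**: the image under `(s^⊓_N)^{bs} : A_N^{bs} ⥲ B_N^{bs}` of the chosen base point `x_{A_N}`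
of the Galois object `A_N^{bs}` through which the setting's Galois surjection `Π^tp_X ↠ Aut(A_N^{bs})` (Def. 4.1 (ii), an OUTER
homomorphism; representative `galoisSurjOf`) — hence `ρ = rhoOfBiKummerData` — is written.  [cite: MochizukiEtTh2009, §5 p.331 (PDF p.105); Def 4.1 (ii) p.313 (PDF p.87)] -/
def rhoBasePt : Rt.BN.base.obj.obj.V :=
  (BiKummerSetting.NthRoot.baseIso (BiKummerSetting.mkOfConnectedTemperoid X (temperedFrobenioid p a ha X.isTempered Rq Sq) (temperedFrobenioid_monoidType p a ha X.isTempered Rq Sq) (hP p a ha X.isTempered Rq Sq) NH A₀ hA₀ hA₀') Rt).hom.hom.hom.hom (galoisBase X.isTempered Rt.AN.base.obj Rt.αData.isGalois)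

/-- **The offset element** `g_N ∈ Π^tp_X` with `x^ρ_{B_N} = g_N · x_{B_N}`, `x_{B_N} := ε(1·U_{B_N})` the base point of `B_N^{bs}` chosen by the
equivalence `CosetCat Π ≌ B^temp(Π)⁰` (through which the hull reads its constants): the two presentations of `B_N^{bs}` differ by `g_N`.
[cite: MochizukiEtTh2009, Def 4.1 (ii) p.313 (PDF p.87)] -/
def offsetElt : X.Pi :=
  Classical.choose (CosetCat.exists_smul_one_eq ((CosetCat.equivConnectedPart X.isTempered).inverse.obj Rt.BN.base)
    (((CosetCat.equivConnectedPart X.isTempered).counitIso.app Rt.BN.base).inv.hom.hom.hom (rhoBasePt p Rt)))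

/-- Defining property of the offset element: `g_N · (1·U_{B_N}) = ε⁻¹(x^ρ_{B_N})`. [cite: MochizukiEtTh2009, Def 4.1 (ii) p.313 (PDF p.87)] -/
theorem offsetElt_smul_one :
    offsetElt p Rt • ((1 : X.Pi) : ((CosetCat.equivConnectedPart X.isTempered).inverse.obj Rt.BN.base).carrier) =
      ((CosetCat.equivConnectedPart X.isTempered).counitIso.app Rt.BN.base).inv.hom.hom.hom (rhoBasePt p Rt) :=
  Classical.choose_spec (CosetCat.exists_smul_one_eq ((CosetCat.equivConnectedPart X.isTempered).inverse.obj Rt.BN.base)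
    (((CosetCat.equivConnectedPart X.isTempered).counitIso.app Rt.BN.base).inv.hom.hom.hom (rhoBasePt p Rt)))

/-- The `ρ`-base point is the `g_N`-translate of the equivalence's base point: `x^ρ_{B_N} = g_N · ε(1·U_{B_N})`.
[cite: MochizukiEtTh2009, Def 4.1 (ii) p.313 (PDF p.87)] -/
theorem rhoBasePt_eq_ρ_offsetElt :
    rhoBasePt p Rt = Rt.BN.base.obj.obj.ρ (offsetElt p Rt)
      (((CosetCat.equivConnectedPart X.isTempered).counitIso.app Rt.BN.base).hom.hom.hom.hom ((1 : X.Pi) : ((CosetCat.equivConnectedPart X.isTempered).inverse.obj Rt.BN.base).carrier)) := by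
  have h := offsetElt_smul_one p Rt
  rw [MulAction.Quotient.smul_coe, smul_eq_mul, mul_one] at h
  have h2 := congrArg (fun z => (((CosetCat.equivConnectedPart X.isTempered).counitIso.app Rt.BN.base).hom.hom.hom.hom z : Rt.BN.base.obj.obj.V)) h
  dsimp only at h2
  have h3 : (((CosetCat.equivConnectedPart X.isTempered).counitIso.app Rt.BN.base).hom.hom.hom.hom
      (((CosetCat.equivConnectedPart X.isTempered).counitIso.app Rt.BN.base).inv.hom.hom.hom (rhoBasePt p Rt)) : Rt.BN.base.obj.obj.V) = rhoBasePt p Rt :=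
    congrArg (fun φ => (φ.hom.hom.hom (rhoBasePt p Rt) : Rt.BN.base.obj.obj.V)) ((CosetCat.equivConnectedPart X.isTempered).counitIso.app Rt.BN.base).inv_hom_id
  rw [h3] at h2
  rw [← h2, ← counitInv_ρ_basePt X.isTempered Rt.BN.base (offsetElt p Rt)]
  exact (congrArg (fun φ => (φ.hom.hom.hom (Rt.BN.base.obj.obj.ρ (offsetElt p Rt)
    (((CosetCat.equivConnectedPart X.isTempered).counitIso.app Rt.BN.base).hom.hom.hom.hom ((1 : X.Pi) : ((CosetCat.equivConnectedPart X.isTempered).inverse.obj Rt.BN.base).carrier))) :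
      Rt.BN.base.obj.obj.V)) ((CosetCat.equivConnectedPart X.isTempered).counitIso.app Rt.BN.base).inv_hom_id)

/-- **The reading of the constants of `B_N` at the `ρ`-compatible base point**: the birational unit, as a `Π^tp_X`-equivariant function on
`B_N^{bs}`, evaluated at `x^ρ_{B_N}` — i.e. `a(g_N) · reading` (abc-iut-L2-d3's `reading` evaluates at `ε(1·U_{B_N})`).
[cite: MochizukiEtTh2009, Lem 5.8 p.331 (PDF p.105); Def 3.6 (iv) p.304 (PDF p.78)] -/
def readingRho : (temperedFrobenioid p a ha X.isTempered Rq Sq).biratUnitsModel Rt.BN →* (PadicAlgCl p)ˣ where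
  toFun u := a (offsetElt p Rt) • reading p a ha X.isTempered Rq Sq Rt.BN u
  map_one' := by rw [map_one, smul_one]
  map_mul' _ _ := by rw [map_mul, smul_mul']

/-- `readingRho u = a(g_N) · reading u`. [cite: MochizukiEtTh2009, Lem 5.8 p.331 (PDF p.105)] -/
theorem readingRho_apply (u : (temperedFrobenioid p a ha X.isTempered Rq Sq).biratUnitsModel Rt.BN) :
    readingRho p Rt u = a (offsetElt p Rt) • reading p a ha X.isTempered Rq Sq Rt.BN u := rfl

/-- **The reading at `x^ρ_{B_N}` is injective.** [cite: MochizukiEtTh2009, Lem 5.8 p.331 (PDF p.105)] -/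
theorem readingRho_injective : Injective (readingRho p Rt) := fun _ _ h =>
  reading_injective p a ha X.isTempered Rq Sq Rt.BN (smul_left_cancel _ h)

variable (Kc : IntermediateField ℚ_[p] (PadicAlgCl p)) (hKc : ∀ g : X.Pi, a g ∈ Kc.fixingSubgroup)

/-- **The constants `K^×` READ onto themselves at `x^ρ_{B_N}`** (`a(Π^tp_X) ≤ G_K` fixes `K`). [cite: MochizukiEtTh2009, Def 3.6 (iv) p.304 (PDF p.78)] -/
theorem readingRho_constEmb (k : (Kc)ˣ) :
    readingRho p Rt (constEmb p a ha Kc hKc X.isTempered Rq Sq Rt.BN k) = unitsOfK p Kc k := by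
  rw [readingRho_apply, reading_constEmb]
  exact smul_eq_of_mem p a Kc hKc (k : Kc).2 _

set_option maxHeartbeats 400000 in
/-- **THE GALOIS LAW at `x^ρ_{B_N}`** («`Π^tp_Y` [i.e., `G_K`, via the natural surjection `Π^tp_Y ↠ G_K`] acts», Lemma 5.8 proof): for an
automorphism `σ` of `B_N` lying over `ρ(y) = (s^⊓_N)^{bs} ∘ galoisSurj_{A_N}(y) ∘ ((s^⊓_N)^{bs})⁻¹` (e.g. `σ = s^⊓-gp_N(ρ(y))`, by
`SgpCapSection`), the natural action of `σ` on a birational unit READS as the Galois action of `a(y)`: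
`readingRho (σ · u) = a(y) · readingRho u` — ON THE NOSE at the `ρ`-compatible base point (at the equivalence's base point one gets
`a(g_N⁻¹ y g_N)` instead).  [cite: MochizukiEtTh2009, Lem 5.8 proof p.331 (PDF p.105); Def 4.1 (iii) p.313 (PDF p.87)] -/
theorem readingRho_biratAutModel_of_baseMap (σ : Aut Rt.BN) (y : X.Pi)
    (hσ : ModelFrobenioid.baseMap σ.inv =
      ((BiKummerSetting.NthRoot.baseIso (BiKummerSetting.mkOfConnectedTemperoid X (temperedFrobenioid p a ha X.isTempered Rq Sq) (temperedFrobenioid_monoidType p a ha X.isTempered Rq Sq) (hP p a ha X.isTempered Rq Sq) NH A₀ hA₀ hA₀') Rt).conjAut ((BiKummerSetting.mkOfConnectedTemperoid X (temperedFrobenioid p a ha X.isTempered Rq Sq) (temperedFrobenioid_monoidType p a ha X.isTempered Rq Sq) (hP p a ha X.isTempered Rq Sq) NH A₀ hA₀ hA₀').galoisSurj Rt.AN.base Rt.αData.isGalois y)).inv)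
    (u : (temperedFrobenioid p a ha X.isTempered Rq Sq).biratUnitsModel Rt.BN) :
    readingRho p Rt ((temperedFrobenioid p a ha X.isTempered Rq Sq).biratAutModel Rt.BN σ u) = a y • readingRho p Rt u := by
  -- the base point of `(equiv).inverse.map Base(σ⁻¹)` is `(g_N⁻¹ y g_N) · U_{B_N}`
  have hpt : CosetCat.pt ((CosetCat.equivConnectedPart X.isTempered).inverse.map (ModelFrobenioid.baseMap σ.inv)) =
      ((offsetElt p Rt)⁻¹ * y * offsetElt p Rt : ((CosetCat.equivConnectedPart X.isTempered).inverse.obj Rt.BN.base).carrier) := by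
    -- `Base(σ⁻¹) = ((s^⊓_N)^{bs})⁻¹ ∘ galoisSurj(y⁻¹) ∘ (s^⊓_N)^{bs}`
    have hmor : ModelFrobenioid.baseMap σ.inv =
        (BiKummerSetting.NthRoot.baseIso (BiKummerSetting.mkOfConnectedTemperoid X (temperedFrobenioid p a ha X.isTempered Rq Sq) (temperedFrobenioid_monoidType p a ha X.isTempered Rq Sq) (hP p a ha X.isTempered Rq Sq) NH A₀ hA₀ hA₀') Rt).inv ≫ ((BiKummerSetting.mkOfConnectedTemperoid X (temperedFrobenioid p a ha X.isTempered Rq Sq) (temperedFrobenioid_monoidType p a ha X.isTempered Rq Sq) (hP p a ha X.isTempered Rq Sq) NH A₀ hA₀ hA₀').galoisSurj Rt.AN.base Rt.αData.isGalois y⁻¹).hom ≫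
          (BiKummerSetting.NthRoot.baseIso (BiKummerSetting.mkOfConnectedTemperoid X (temperedFrobenioid p a ha X.isTempered Rq Sq) (temperedFrobenioid_monoidType p a ha X.isTempered Rq Sq) (hP p a ha X.isTempered Rq Sq) NH A₀ hA₀ hA₀') Rt).hom := by
      rw [hσ]
      change (((BiKummerSetting.NthRoot.baseIso (BiKummerSetting.mkOfConnectedTemperoid X (temperedFrobenioid p a ha X.isTempered Rq Sq) (temperedFrobenioid_monoidType p a ha X.isTempered Rq Sq) (hP p a ha X.isTempered Rq Sq) NH A₀ hA₀ hA₀') Rt).conjAut ((BiKummerSetting.mkOfConnectedTemperoid X (temperedFrobenioid p a ha X.isTempered Rq Sq) (temperedFrobenioid_monoidType p a ha X.isTempered Rq Sq) (hP p a ha X.isTempered Rq Sq) NH A₀ hA₀ hA₀').galoisSurj Rt.AN.base Rt.αData.isGalois y))⁻¹).hom = _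
      rw [← map_inv, ← map_inv, Iso.conjAut_hom, Iso.conj_apply]
    apply pt_inverse_map_eq
    rw [hmor]
    -- `x_{B_N} = (s^⊓_N)^{bs} (g_N⁻¹ · x_{A_N})`
    have hxB : (((CosetCat.equivConnectedPart X.isTempered).counitIso.app Rt.BN.base).hom.hom.hom.hom ((1 : X.Pi) : ((CosetCat.equivConnectedPart X.isTempered).inverse.obj Rt.BN.base).carrier) :
        Rt.BN.base.obj.obj.V) =
        (BiKummerSetting.NthRoot.baseIso (BiKummerSetting.mkOfConnectedTemperoid X (temperedFrobenioid p a ha X.isTempered Rq Sq) (temperedFrobenioid_monoidType p a ha X.isTempered Rq Sq) (hP p a ha X.isTempered Rq Sq) NH A₀ hA₀ hA₀') Rt).hom.hom.hom.hom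
          (Rt.AN.base.obj.obj.ρ (offsetElt p Rt)⁻¹ (galoisBase X.isTempered Rt.AN.base.obj Rt.αData.isGalois)) := by
      rw [hom_ρ (BiKummerSetting.NthRoot.baseIso (BiKummerSetting.mkOfConnectedTemperoid X (temperedFrobenioid p a ha X.isTempered Rq Sq) (temperedFrobenioid_monoidType p a ha X.isTempered Rq Sq) (hP p a ha X.isTempered Rq Sq) NH A₀ hA₀ hA₀') Rt).hom.hom]
      change _ = Rt.BN.base.obj.obj.ρ (offsetElt p Rt)⁻¹ (rhoBasePt p Rt)
      rw [rhoBasePt_eq_ρ_offsetElt, ρ_inv_apply]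
    -- `((s^⊓_N)^{bs})⁻¹ x_{B_N} = g_N⁻¹ · x_{A_N}`
    have hinv : ((BiKummerSetting.NthRoot.baseIso (BiKummerSetting.mkOfConnectedTemperoid X (temperedFrobenioid p a ha X.isTempered Rq Sq) (temperedFrobenioid_monoidType p a ha X.isTempered Rq Sq) (hP p a ha X.isTempered Rq Sq) NH A₀ hA₀ hA₀') Rt).inv.hom.hom.hom
        (((CosetCat.equivConnectedPart X.isTempered).counitIso.app Rt.BN.base).hom.hom.hom.hom ((1 : X.Pi) : ((CosetCat.equivConnectedPart X.isTempered).inverse.obj Rt.BN.base).carrier)) :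
          Rt.AN.base.obj.obj.V) =
        Rt.AN.base.obj.obj.ρ (offsetElt p Rt)⁻¹ (galoisBase X.isTempered Rt.AN.base.obj Rt.αData.isGalois) := by
      rw [hxB]
      exact congrArg (fun φ => (φ.hom.hom.hom (Rt.AN.base.obj.obj.ρ (offsetElt p Rt)⁻¹
        (galoisBase X.isTempered Rt.AN.base.obj Rt.αData.isGalois)) : Rt.AN.base.obj.obj.V))
        (BiKummerSetting.NthRoot.baseIso (BiKummerSetting.mkOfConnectedTemperoid X (temperedFrobenioid p a ha X.isTempered Rq Sq) (temperedFrobenioid_monoidType p a ha X.isTempered Rq Sq) (hP p a ha X.isTempered Rq Sq) NH A₀ hA₀ hA₀') Rt).hom_inv_id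
    change ((BiKummerSetting.NthRoot.baseIso (BiKummerSetting.mkOfConnectedTemperoid X (temperedFrobenioid p a ha X.isTempered Rq Sq) (temperedFrobenioid_monoidType p a ha X.isTempered Rq Sq) (hP p a ha X.isTempered Rq Sq) NH A₀ hA₀ hA₀') Rt).hom.hom.hom.hom
      (((BiKummerSetting.mkOfConnectedTemperoid X (temperedFrobenioid p a ha X.isTempered Rq Sq) (temperedFrobenioid_monoidType p a ha X.isTempered Rq Sq) (hP p a ha X.isTempered Rq Sq) NH A₀ hA₀ hA₀').galoisSurj Rt.AN.base Rt.αData.isGalois y⁻¹).hom.hom.hom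
        ((BiKummerSetting.NthRoot.baseIso (BiKummerSetting.mkOfConnectedTemperoid X (temperedFrobenioid p a ha X.isTempered Rq Sq) (temperedFrobenioid_monoidType p a ha X.isTempered Rq Sq) (hP p a ha X.isTempered Rq Sq) NH A₀ hA₀ hA₀') Rt).inv.hom.hom.hom
          (((CosetCat.equivConnectedPart X.isTempered).counitIso.app Rt.BN.base).hom.hom.hom.hom ((1 : X.Pi) : ((CosetCat.equivConnectedPart X.isTempered).inverse.obj Rt.BN.base).carrier)))) :
        Rt.BN.base.obj.obj.V) = _
    rw [hinv, BiKummerSetting.mkOfConnectedTemperoid_galoisSurj_hom_hom]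
    have happ := galoisSurjOf_apply X.isTempered Rt.AN.base.obj Rt.αData.isGalois y⁻¹ (offsetElt p Rt)⁻¹
    rw [inv_inv] at happ
    change ((BiKummerSetting.NthRoot.baseIso (BiKummerSetting.mkOfConnectedTemperoid X (temperedFrobenioid p a ha X.isTempered Rq Sq) (temperedFrobenioid_monoidType p a ha X.isTempered Rq Sq) (hP p a ha X.isTempered Rq Sq) NH A₀ hA₀ hA₀') Rt).hom.hom.hom.hom
      ((galoisSurjOf X.isTempered Rt.AN.base.obj Rt.αData.isGalois y⁻¹).hom.hom.hom
        (Rt.AN.base.obj.obj.ρ (offsetElt p Rt)⁻¹ (galoisBase X.isTempered Rt.AN.base.obj Rt.αData.isGalois))) :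
        Rt.BN.base.obj.obj.V) = _
    rw [happ, hom_ρ (BiKummerSetting.NthRoot.baseIso (BiKummerSetting.mkOfConnectedTemperoid X (temperedFrobenioid p a ha X.isTempered Rq Sq) (temperedFrobenioid_monoidType p a ha X.isTempered Rq Sq) (hP p a ha X.isTempered Rq Sq) NH A₀ hA₀ hA₀') Rt).hom.hom]
    change Rt.BN.base.obj.obj.ρ ((offsetElt p Rt)⁻¹ * y) (rhoBasePt p Rt) = _
    rw [rhoBasePt_eq_ρ_offsetElt, ← ρ_mul_apply]
  rw [readingRho_apply, readingRho_apply, reading_biratAutModel p a ha X.isTempered Rq Sq Rt.BN σ u hpt, smul_smul, smul_smul,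
    ← map_mul, ← map_mul, mul_assoc, mul_inv_cancel_left]


/-! ## §3 The cyclotome identification `μ_N(B_N) ≃ μ_N(ℚ̄_p)` for the §5 data over the hull -/

variable (h : ModelFrobenioid.Hypotheses (temperedFrobenioid p a ha X.isTempered Rq Sq).divisorMonoid (temperedFrobenioid p a ha X.isTempered Rq Sq).ratFnFunctor)
  (Q : FrobenioidTheta.ThetaSubquotientStub.{0} (ConnectedPart (BTemp X.Pi))) (odd_l : Odd (lv : ℕ)) {T : ThetaEnvData.{0} N}
  (ιX : T.PiX ≃ₜ* X.Pi) (K' : Type) [Field K'] (cE : K'ˣ →* (temperedFrobenioid p a ha X.isTempered Rq Sq).biratUnitsModel Rt.BN) (cE_inj : Function.Injective cE)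
  (hinvc : ∀ g : Aut Rt.AN.base, pull (temperedFrobenioid p a ha X.isTempered Rq Sq).divisorMonoid g.hom (ModelFrobenioid.div Rt.pair.num) = ModelFrobenioid.div Rt.pair.num)
  (hinvp : ∀ y : T.PiX, y ∈ T.PiYdd →
    pull (temperedFrobenioid p a ha X.isTempered Rq Sq).divisorMonoid ((BiKummerSetting.mkOfConnectedTemperoid X (temperedFrobenioid p a ha X.isTempered Rq Sq) (temperedFrobenioid_monoidType p a ha X.isTempered Rq Sq) (hP p a ha X.isTempered Rq Sq) NH A₀ hA₀ hA₀').galoisSurj Rt.AN.base Rt.αData.isGalois (ιX y)).hom (ModelFrobenioid.div Rt.pair.den) =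
      ModelFrobenioid.div Rt.pair.den)

/-- **`μ_N(B_N) → μ_N(ℚ̄_p)`**: an `N`-torsion unit of `B_N`, read through `O^×(B_N) ↪ O^×(B_N^birat)` ([FrdI] Thm. 5.2 (ii)) at the
`ρ`-compatible base point, is an `N`-th root of unity in `ℚ̄_p` (Lemma 5.8: «`μ_N(B_N) ⊆ (K^×)^{1/N}`»).  For the §5 data
`ofConnectedTemperoidData` over the hull.  [cite: MochizukiEtTh2009, Lem 5.8 p.331 (PDF p.105); Def 5.4 p.327 (PDF p.101)] -/
def muReadingHom : (ThetaFrobenioid.ofConnectedTemperoidData h Q odd_l Rt ιX K' cE cE_inj hinvc hinvp).muTorsion (ThetaFrobenioid.ofConnectedTemperoidData h Q odd_l Rt ιX K' cE cE_inj hinvc hinvp).BN N →* MuN p N :=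
  ((readingRho p Rt).comp (((ThetaFrobenioid.ofConnectedTemperoidData h Q odd_l Rt ιX K' cE cE_inj hinvc hinvp).unitsToBirat (ThetaFrobenioid.ofConnectedTemperoidData h Q odd_l Rt ιX K' cE cE_inj hinvc hinvp).BN).comp (Subgroup.inclusion ((ThetaFrobenioid.ofConnectedTemperoidData h Q odd_l Rt ιX K' cE cE_inj hinvc hinvp).muTorsion_le_units (ThetaFrobenioid.ofConnectedTemperoidData h Q odd_l Rt ιX K' cE cE_inj hinvc hinvp).BN N)))).codRestrict
    (rootsOfUnity N (PadicAlgCl p)) fun u => by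
      rw [mem_rootsOfUnity, ← map_pow]
      have hu : u ^ (N : ℕ) = 1 := Subtype.ext (by rw [SubgroupClass.coe_pow]; exact u.2.2)
      rw [hu, map_one]

/-- Values of `muReadingHom`. [cite: MochizukiEtTh2009, Lem 5.8 p.331 (PDF p.105)] -/
theorem coe_muReadingHom (u : (ThetaFrobenioid.ofConnectedTemperoidData h Q odd_l Rt ιX K' cE cE_inj hinvc hinvp).muTorsion (ThetaFrobenioid.ofConnectedTemperoidData h Q odd_l Rt ιX K' cE cE_inj hinvc hinvp).BN N) :
    ((muReadingHom p Rt h Q odd_l ιX K' cE cE_inj hinvc hinvp u : MuN p N) : (PadicAlgCl p)ˣ) =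
      readingRho p Rt ((ThetaFrobenioid.ofConnectedTemperoidData h Q odd_l Rt ιX K' cE cE_inj hinvc hinvp).muToBirat u) := rfl

/-- `muReadingHom` is injective (`O^×(B_N) ↪ O^×(B_N^birat)` and the reading are). [cite: MochizukiEtTh2009, Lem 5.8 p.331 (PDF p.105)] -/
theorem muReadingHom_injective : Injective (muReadingHom p Rt h Q odd_l ιX K' cE cE_inj hinvc hinvp) := by
  intro u v huv
  have h1 := congrArg (fun z : MuN p N => (z : (PadicAlgCl p)ˣ)) huv
  simp only [coe_muReadingHom] at h1
  exact (ThetaFrobenioid.ofConnectedTemperoidData h Q odd_l Rt ιX K' cE cE_inj hinvc hinvp).muToBirat_injective (readingRho_injective p Rt h1)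

set_option maxHeartbeats 800000 in
/-- **`muReadingHom` is surjective as soon as `μ_N(ℚ̄_p) ⊆ K_{U_{B_N}}`** (which the Def. 5.4 slot guarantees): the constant function with
value `a(g_N)⁻¹·ζ` has trivial divisor, hence is `u_τ` for a unit `τ ∈ O^×(B_N)` ([FrdI] Thm. 5.2 (ii): abc-iut-w6-d037's
`exists_units_unitsToRatFn_eq`), `N`-torsion by injectivity.  [cite: MochizukiEtTh2009, Lem 5.8 p.331 (PDF p.105); Def 5.4 p.327 (PDF p.101)] -/
theorem muReadingHom_surjective
    (hμN : ∀ ζ : PadicAlgCl p, ζ ^ (N : ℕ) = 1 → ζ ∈ fixFld p a ((CosetCat.equivConnectedPart X.isTempered).inverse.obj Rt.BN.base).sg) :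
    Surjective (muReadingHom p Rt h Q odd_l ιX K' cE cE_inj hinvc hinvp) := by
  intro ζ
  -- the twisted value `ζ' := a(g_N)⁻¹ · ζ`, an `N`-th root of unity in `K_{U_{B_N}}`
  have hζ'N : ((a (offsetElt p Rt))⁻¹ • (ζ : (PadicAlgCl p)ˣ)) ^ (N : ℕ) = 1 := by
    rw [← smul_pow', show ((ζ : (PadicAlgCl p)ˣ)) ^ (N : ℕ) = 1 from (mem_rootsOfUnity _ _).mp ζ.2, smul_one]
  have hζ'U : ((((a (offsetElt p Rt))⁻¹ • (ζ : (PadicAlgCl p)ˣ) : (PadicAlgCl p)ˣ)) : PadicAlgCl p) ∈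
      fixFld p a ((CosetCat.equivConnectedPart X.isTempered).inverse.obj Rt.BN.base).sg :=
    hμN _ (by rw [← Units.val_pow_eq_pow_val, hζ'N, Units.val_one])
  -- the constant function `b` with value `ζ'`
  obtain ⟨b, hb⟩ : ∃ b : eqvFun p a ((CosetCat.equivConnectedPart X.isTempered).inverse.obj Rt.BN.base),
      ev p a _ b = (a (offsetElt p Rt))⁻¹ • (ζ : (PadicAlgCl p)ˣ) :=
    ⟨ofFixed p a _ _ hζ'U, ev_ofFixed p a _ _ hζ'U⟩
  have hbN : b ^ (N : ℕ) = 1 := by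
    apply ev_injective p a ((CosetCat.equivConnectedPart X.isTempered).inverse.obj Rt.BN.base)
    rw [map_pow, hb, hζ'N, map_one]
  -- the birational unit `unitsEquiv b` has `Div_B = 0` (torsion function), so it is `u_τ` for a unit `τ`
  have hdiv : divB (temperedFrobenioid p a ha X.isTempered Rq Sq).divisorMonoid (temperedFrobenioid p a ha X.isTempered Rq Sq).ratFnFunctor (temperedFrobenioid p a ha X.isTempered Rq Sq).divBNatTrans (op Rt.BN.base)
      ((unitsEquiv p a ha X.isTempered Rq Sq Rt.BN b : (temperedFrobenioid p a ha X.isTempered Rq Sq).biratUnitsModel Rt.BN) : (temperedFrobenioid p a ha X.isTempered Rq Sq).ratFnFunctor.obj (op Rt.BN.base)) = 1 := by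
    change gpMap (TemperedFrobenioid.RankOneBase.toPfImage (hpf p a ha) (rankOneBase p a ha X.isTempered) (op Rt.BN.base))
        (divZero p a ha ((CosetCat.equivConnectedPart X.isTempered).inverse.obj Rt.BN.base) b) = 1
    rw [divZero_eq_one_of_pow_eq_one p a ha ((CosetCat.equivConnectedPart X.isTempered).inverse.obj Rt.BN.base) b N.pos hbN]
    exact map_one _
  obtain ⟨τ, hτ⟩ := (temperedFrobenioid p a ha X.isTempered Rq Sq).exists_units_unitsToRatFn_eq Rt.BN _ hdiv
  -- `τ` is `N`-torsion: `u_{τ^N} = (u_τ)^N = unitsEquiv (b^N) = 1` and `O^×(B_N) ↪ B(B_N^{bs})^×` ([FrdI] Thm. 5.2 (ii))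
  have hxN : (unitsEquiv p a ha X.isTempered Rq Sq Rt.BN b) ^ (N : ℕ) = 1 :=
    (map_pow (unitsEquiv p a ha X.isTempered Rq Sq Rt.BN) b (N : ℕ)).symm.trans (by rw [hbN, map_one])
  have e1 := map_pow (ModelFrobenioid.unitsToRatFn _) τ (N : ℕ)
  have e2 := (congrArg (fun w => w ^ (N : ℕ)) hτ).trans hxN
  have hτN0 : τ ^ (N : ℕ) = 1 :=
    ModelFrobenioid.unitsToRatFn_injective (h.isDivisorial _).isPreDivisorial.isIntegral
      (e1.trans (e2.trans (map_one (ModelFrobenioid.unitsToRatFn _)).symm))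
  have hτN' : (τ.1 : Aut (ThetaFrobenioid.ofConnectedTemperoidData h Q odd_l Rt ιX K' cE cE_inj hinvc hinvp).BN) ^ (N : ℕ) = 1 := by
    have h3 := congrArg (fun z : ModelFrobenioid.units Rt.BN => z.1) hτN0
    rw [SubgroupClass.coe_pow, OneMemClass.coe_one] at h3
    exact h3
  -- `τ` as a unit of the §5 data (same subgroup, definitionally)
  have hτu : (ThetaFrobenioid.ofConnectedTemperoidData h Q odd_l Rt ιX K' cE cE_inj hinvc hinvp).unitsToBirat (ThetaFrobenioid.ofConnectedTemperoidData h Q odd_l Rt ιX K' cE cE_inj hinvc hinvp).BN ⟨τ.1, τ.2⟩ = unitsEquiv p a ha X.isTempered Rq Sq Rt.BN b := hτ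
  refine ⟨⟨τ.1, τ.2, hτN'⟩, ?_⟩
  apply Subtype.ext
  rw [coe_muReadingHom]
  change readingRho p Rt ((ThetaFrobenioid.ofConnectedTemperoidData h Q odd_l Rt ιX K' cE cE_inj hinvc hinvp).unitsToBirat (ThetaFrobenioid.ofConnectedTemperoidData h Q odd_l Rt ιX K' cE cE_inj hinvc hinvp).BN ⟨τ.1, τ.2⟩) = _
  rw [hτu, readingRho_apply, reading_unitsEquiv, hb, smul_inv_smul]

/-- **THE CYCLOTOME IDENTIFICATION `m : μ_N(B_N) ⥲ μ_N(ℚ̄_p) = T.mu`** for the §5 data over the hull, under the Def. 5.4 slot consequence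
`μ_N(ℚ̄_p) ⊆ K_{U_{B_N}}` (the datum `m` of abc-iut-L2-t11's `ConstantsDictionary`; print: «`μ_N(B_N) ⊆ (K^×)^{1/N}`», the cyclotome of
`B_N` read in `ℚ̄_p`).  [cite: MochizukiEtTh2009, Lem 5.8 p.331 (PDF p.105); Def 5.4 p.327 (PDF p.101)] -/
def muReadingEquiv (hμN : ∀ ζ : PadicAlgCl p, ζ ^ (N : ℕ) = 1 → ζ ∈ fixFld p a ((CosetCat.equivConnectedPart X.isTempered).inverse.obj Rt.BN.base).sg) :
    (ThetaFrobenioid.ofConnectedTemperoidData h Q odd_l Rt ιX K' cE cE_inj hinvc hinvp).muTorsion (ThetaFrobenioid.ofConnectedTemperoidData h Q odd_l Rt ιX K' cE cE_inj hinvc hinvp).BN N ≃* MuN p N :=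
  MulEquiv.ofBijective (muReadingHom p Rt h Q odd_l ιX K' cE cE_inj hinvc hinvp)
    ⟨muReadingHom_injective p Rt h Q odd_l ιX K' cE cE_inj hinvc hinvp,
      muReadingHom_surjective p Rt h Q odd_l ιX K' cE cE_inj hinvc hinvp hμN⟩

/-- Values of the cyclotome identification: `m(u) = readingRho (μ_N(B_N) ↪ O^×(B_N^birat)) (u)` — the law `mu_compat` of the dictionary
holds BY CONSTRUCTION.  [cite: MochizukiEtTh2009, Lem 5.8 p.331 (PDF p.105)] -/
theorem coe_muReadingEquiv (hμN : ∀ ζ : PadicAlgCl p, ζ ^ (N : ℕ) = 1 → ζ ∈ fixFld p a ((CosetCat.equivConnectedPart X.isTempered).inverse.obj Rt.BN.base).sg)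
    (u : (ThetaFrobenioid.ofConnectedTemperoidData h Q odd_l Rt ιX K' cE cE_inj hinvc hinvp).muTorsion (ThetaFrobenioid.ofConnectedTemperoidData h Q odd_l Rt ιX K' cE cE_inj hinvc hinvp).BN N) :
    ((muReadingEquiv p Rt h Q odd_l ιX K' cE cE_inj hinvc hinvp hμN u : MuN p N) : (PadicAlgCl p)ˣ) =
      readingRho p Rt ((ThetaFrobenioid.ofConnectedTemperoidData h Q odd_l Rt ιX K' cE cE_inj hinvc hinvp).muToBirat u) := rfl

end OffsetReading

end BsFldHull

end Literature.AnabelianGeometry.EtaleTheta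

end
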